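import Summits.BirchSwinnertonDyer.Rank1Residual.ManinAdditive.SigmaEtaKummer
import Summits.BirchSwinnertonDyer.BirchSwinnertonDyer.Theorems.PrintCFramBottomClassIndexLawFiveLeCuspSeedFamilyWeight
import HarnessLib

/-!
# The 2-adic PARITY LEMMAS behind node S-an-g34-2 `SigmaEta.KroneckerShimuraCharAtFour`:
# even cusp orders of `G_{2r}` at the cusps `1/2^k` of `X₀(N)` force
# «`v₂(∏ t^{r_t})` odd ⟹ 32 ∣ N» and «#{t : r_t odd, odd part of t ≡ 3 (4)} odd ⟹ 8 ∣ N»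
# (route `ManinLocalTwoThree`, cell bsd-f2-manin, an lane E-an-155; prover seat p3 gen 13)

THE POINT.  an's node (MEMO-an §77.11–77.12, `SigmaTheta.lean`) asks for an even quadratic Dirichlet character `χ mod N`
with `χ(d) = (s′ | |d|)`, `s′ = ∏_{t ∣ N} t^{|r_t|}`, killing the cusp stabilisers of `Γ₀(N)`, granted Newman's conditions for
`2r` and EVEN cusp orders of `G_{2r} = ∏ η(tτ)^{2 r_t}` (Ligozat).  The character is `χ₈^{E}·χ₋₄^{F}·∏_t (·/u_t)^{|r_t|}`
(`u_t` the odd part of `t`, `E = Σ |r_t| v₂(t)`, `F = #{t : r_t odd, u_t ≡ 3 (4)}`), which is a character mod `N` killing the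
stabilisers iff `2^{v₂(cond)} ∣ 2^{⌈v₂ N/2⌉}`, i.e. iff  (A) `E` odd ⟹ `32 ∣ N`  and  (B) `F` odd ⟹ `8 ∣ N`.  an proved (A) at
`4 ∥ N` by hand (§77.11 (3), the «v₂-lemma» at the cusps `1, 1/2, 1/4`); this file proves (A) at `4 ∥ N`, `8 ∥ N`, `16 ∥ N`
and (B) at `4 ∥ N`, from the cusps `1/2^k` alone plus the weight condition `Σ r_t = 0`:

* `cuspOrder24_two_pow` — Ligozat's `24N·ord` at `c = 2^k` regrouped by `a = v₂(t)`:
  `Σ_t r_t gcd(t,2^k)² (N/t) = Σ_a 2^{2 min(a,k) + v₂N − a} · R_a`, `R_a := Σ_{v₂ t = a} r_t · oddpart(N/t)`;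
* `two_pow_dvd_sum_R_of_hasEvenCuspOrders` — even orders at `c = 2^k` (`k ≤ v₂ N`) read `2^{3+k+min(k, v₂N−k)} ∣ Σ_a 2^{…} R_a`;
* `R_parity_of_two` / `_three` / `_four` — `v₂ N = 2 ⟹ 8 ∣ R₀, 4 ∣ R₁, 8 ∣ R₂`; `v₂ N = 3 ⟹ 2 ∣ R₀, R₂`;
  `v₂ N = 4 ⟹ 2 ∣ R₀, R₂, R₄` (linear algebra mod `2⁷`, `omega`);
* `even_twoAdicWeight_of_hasEvenCuspOrders` — (A): `4 ∣ N`, `¬ 32 ∣ N`, `Σ r_t = 0` ⟹ `Σ_t |r_t|·v₂(t)` even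
  (`R_a ≡ Σ_{v₂ t = a} r_t (mod 2)`, so `Σ_{a even} ≡ 0`, and `Σ_{a odd} = −Σ_{a even}`);
* `even_threeModFourCount_of_hasEvenCuspOrders` — (B): `4 ∥ N`, `Σ r_t = 0` ⟹ `#{t : |r_t| odd, u_t ≡ 3 (4)}` even
  (`4 ∣ R₀+R₁+R₂ = Σ_t r_t·oddpart(N/t) ≡ m·Σ_t r_t u_t (mod 4)`, `m = oddpart N`, and `u_t ≡ 1 + 2·[u_t ≡ 3 (4)] (mod 4)`).

Checked numerically before formalisation (seat folder `scratch/lattice.py`): exact integer solution lattices of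
{`Σ r = 0`, Newman, all cusp-order divisibilities} for every `4 ∣ N < 520` — (A), (B) hold on every basis vector, and FAIL
without `Σ r_t = 0` (e.g. `N = 12, 16`), so the weight condition is essential.

HONEST FRAMING.  Elementary 2-adic bookkeeping of Ligozat's cusp-order formula; no law is touched; an's E-an-155 becomes a
theorem only with the companion assembly file (`…KroneckerShimuraCharHolds.lean`).  BSD, Manin's conjecture and C2/C3 are NOT
proved by anything here.  No definitions, no sorry, axioms standard.

[cite: Newman1959, Thm. 1 (the η-quotient conditions; shape)] [cite: LingOesterle1991, Thm. 6 (Σ(N); shape)]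
-/

set_option autoImplicit false
-- lint-debt: the directory name repeats the summit name (sibling precedent `ManinLocalTwoThreeGammaOneKatoRoad.lean`)
set_option linter.dupNamespace false

open Finset
open Literature.NumberTheory.EllipticCurves.ModularForms (cuspOrder24 NewmanCond)
open Summit.BirchSwinnertonDyer.Rank1Residual.ManinAdditive.SigmaEta
-- the one-liner `Odd (ordCompl[2] n)` already lives in a sibling Theorems file (dedup): reuse it
open Summit.BirchSwinnertonDyer.BirchSwinnertonDyer.Theorems.PrintCFram.FamilyMean (odd_ordCompl_two)

namespace Summit.BirchSwinnertonDyer.BirchSwinnertonDyer.Theorems.ManinLocalTwoThree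

/-! ## §1 Pointwise 2-adic bookkeeping on the divisors of `N` -/

/-- `gcd(δ, 2^k) = 2^{min(v₂ δ, k)}` for `δ ≠ 0`. -/
theorem gcd_two_pow_eq_two_pow_min {δ : ℕ} (hδ : δ ≠ 0) (k : ℕ) :
    Nat.gcd δ (2 ^ k) = 2 ^ min (δ.factorization 2) k := by
  have hg0 : Nat.gcd δ (2 ^ k) ≠ 0 := (Nat.gcd_pos_of_pos_left _ (Nat.pos_of_ne_zero hδ)).ne'
  apply Nat.eq_pow_of_factorization_eq_single hg0
  rw [Nat.factorization_gcd hδ (pow_ne_zero k two_ne_zero), Nat.Prime.factorization_pow Nat.prime_two]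
  ext q
  rw [Finsupp.inf_apply, Finsupp.single_apply, Finsupp.single_apply]
  by_cases hq : 2 = q
  · subst hq; simp
  · simp [hq]

/-- For `δ ∣ N ≠ 0`: `v₂ δ ≤ v₂ N`. -/
theorem factorization_two_le_of_dvd {N δ : ℕ} (hN : N ≠ 0) (hδN : δ ∣ N) :
    δ.factorization 2 ≤ N.factorization 2 := by
  have hδ : δ ≠ 0 := by rintro rfl; exact hN (zero_dvd_iff.mp hδN)
  exact (Nat.factorization_le_iff_dvd hδ hN).mpr hδN 2

/-- For `δ ∣ N`: `v₂(N/δ) = v₂ N − v₂ δ`. -/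
theorem factorization_two_div {N δ : ℕ} (hδN : δ ∣ N) :
    (N / δ).factorization 2 = N.factorization 2 - δ.factorization 2 := by
  rw [Nat.factorization_div hδN, Finsupp.tsub_apply]

/-- For `δ ∣ N ≠ 0`: `N/δ = 2^{v₂N − v₂δ} · oddpart(N/δ)` (as integers). -/
theorem div_eq_two_pow_mul_ordCompl {N δ : ℕ} (hδN : δ ∣ N) :
    ((N / δ : ℕ) : ℤ) = (2 : ℤ) ^ (N.factorization 2 - δ.factorization 2) * (ordCompl[2] (N / δ) : ℤ) := by
  have h := Nat.ordProj_mul_ordCompl_eq_self (N / δ) 2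
  have h1 : ((ordProj[2] (N / δ) : ℕ) : ℤ) = (2 : ℤ) ^ (N.factorization 2 - δ.factorization 2) := by
    rw [factorization_two_div hδN, Nat.cast_pow, Nat.cast_ofNat]
  calc ((N / δ : ℕ) : ℤ) = ((ordProj[2] (N / δ) * ordCompl[2] (N / δ) : ℕ) : ℤ) := by rw [h]
    _ = ((ordProj[2] (N / δ) : ℕ) : ℤ) * (ordCompl[2] (N / δ) : ℤ) := Nat.cast_mul _ _
    _ = _ := by rw [h1]

/-! ## §2 Ligozat's order at the cusp `1/2^k`, regrouped by `v₂` -/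

/-- **`cuspOrder24` is additive-homogeneous: `cuspOrder24 N (2r) c = 2 · cuspOrder24 N r c`.** -/
theorem cuspOrder24_two_mul (N : ℕ) (r : ℕ → ℤ) (c : ℤ) :
    cuspOrder24 N (fun t => 2 * r t) c = 2 * cuspOrder24 N r c := by
  unfold cuspOrder24
  rw [Finset.mul_sum]
  exact Finset.sum_congr rfl fun δ _ => by ring

/-- **Ligozat at `c = 2^k`, regrouped by `a = v₂(t)`**:
`Σ_{t ∣ N} r_t gcd(t, 2^k)² (N/t) = Σ_{a ≤ v₂N} 2^{2 min(a,k) + (v₂N − a)} · R_a` with `R_a = Σ_{v₂ t = a} r_t · oddpart(N/t)`. -/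
theorem cuspOrder24_two_pow {N : ℕ} (hN : N ≠ 0) (r : ℕ → ℤ) (k : ℕ) :
    cuspOrder24 N r ((2 ^ k : ℕ) : ℤ) =
      ∑ a ∈ range (N.factorization 2 + 1), (2 : ℤ) ^ (2 * min a k + (N.factorization 2 - a)) *
        ∑ δ ∈ N.divisors with δ.factorization 2 = a, r δ * (ordCompl[2] (N / δ) : ℤ) := by
  unfold cuspOrder24
  have hmaps : ∀ δ ∈ N.divisors, δ.factorization 2 ∈ range (N.factorization 2 + 1) := fun δ hδ =>
    mem_range.mpr (Nat.lt_succ_of_le (factorization_two_le_of_dvd hN (Nat.dvd_of_mem_divisors hδ)))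
  rw [← sum_fiberwise_of_maps_to hmaps]
  refine sum_congr rfl fun a _ => ?_
  rw [mul_sum]
  refine sum_congr rfl fun δ hδ => ?_
  obtain ⟨hδ, hfa⟩ := mem_filter.mp hδ
  have hδN : δ ∣ N := Nat.dvd_of_mem_divisors hδ
  have hδ0 : δ ≠ 0 := by rintro rfl; exact hN (zero_dvd_iff.mp hδN)
  rw [Int.gcd_natCast_natCast, gcd_two_pow_eq_two_pow_min hδ0 k, hfa, div_eq_two_pow_mul_ordCompl hδN, hfa]
  push_cast
  ring

/-- **Even cusp orders of `G_{2r}` at `c = 2^k` (`k ≤ v₂ N`) in `R`-form**: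
`2^{3 + k + min(k, v₂N − k)} ∣ Σ_a 2^{2 min(a,k) + (v₂N − a)} R_a` (the factor `3` of `24` and the doubling dropped). -/
theorem two_pow_dvd_sum_R_of_hasEvenCuspOrders {N : ℕ} (hN : N ≠ 0) {r : ℕ → ℤ}
    (hev : HasEvenCuspOrders N (fun t => 2 * r t)) {k : ℕ} (hk : k ≤ N.factorization 2) :
    (2 : ℤ) ^ (3 + k + min k (N.factorization 2 - k)) ∣
      ∑ a ∈ range (N.factorization 2 + 1), (2 : ℤ) ^ (2 * min a k + (N.factorization 2 - a)) *
        ∑ δ ∈ N.divisors with δ.factorization 2 = a, r δ * (ordCompl[2] (N / δ) : ℤ) := by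
  -- `2^k ∣ N`
  have h2k : 2 ^ k ∣ N := (pow_dvd_pow 2 hk).trans (Nat.ordProj_dvd N 2)
  have hmem : 2 ^ k ∈ N.divisors := Nat.mem_divisors.mpr ⟨h2k, hN⟩
  have h := hev (2 ^ k) hmem
  -- the width factor `gcd(2^k, N/2^k) = 2^{min(k, v₂N − k)}`
  have hq0 : N / 2 ^ k ≠ 0 := (Nat.div_pos (Nat.le_of_dvd (Nat.pos_of_ne_zero hN) h2k) (by positivity)).ne'
  have hgcd : Nat.gcd (2 ^ k) (N / 2 ^ k) = 2 ^ min k (N.factorization 2 - k) := by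
    rw [Nat.gcd_comm, gcd_two_pow_eq_two_pow_min hq0 k, factorization_two_div h2k,
      Nat.Prime.factorization_pow Nat.prime_two, Finsupp.single_eq_same, min_comm]
  rw [hgcd, cuspOrder24_two_mul, cuspOrder24_two_pow hN r k] at h
  -- `48 · 2^k · 2^m ∣ 2·S ⟹ 2^{3+k+m} ∣ S`
  set S := ∑ a ∈ range (N.factorization 2 + 1), (2 : ℤ) ^ (2 * min a k + (N.factorization 2 - a)) *
        ∑ δ ∈ N.divisors with δ.factorization 2 = a, r δ * (ordCompl[2] (N / δ) : ℤ) with hS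
  have h' : (2 : ℤ) * (3 * 2 ^ (3 + k + min k (N.factorization 2 - k))) ∣ 2 * S := by
    have e : (48 * ((2 ^ k : ℕ) : ℤ) * ((2 ^ min k (N.factorization 2 - k) : ℕ) : ℤ)) =
        2 * (3 * 2 ^ (3 + k + min k (N.factorization 2 - k))) := by
      push_cast; ring
    rwa [e] at h
  exact (Dvd.intro_left _ rfl).trans ((mul_dvd_mul_iff_left (two_ne_zero)).mp h')


/-! ## §3 The `R`-parities level by level (`v₂ N = 2, 3, 4`) -/

/-- **`4 ∥ N`: `8 ∣ R₀`, `4 ∣ R₁`, `8 ∣ R₂`** from the cusps `1, 1/2, 1/4` (an's v₂-lemma, MEMO-an §77.11 (3), sharpened). -/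
theorem R_parity_of_factorization_two_eq_two {N : ℕ} (hN : N ≠ 0) {r : ℕ → ℤ}
    (hev : HasEvenCuspOrders N (fun t => 2 * r t)) (hn : N.factorization 2 = 2) :
    (8 : ℤ) ∣ ∑ δ ∈ N.divisors with δ.factorization 2 = 0, r δ * (ordCompl[2] (N / δ) : ℤ) ∧
    (4 : ℤ) ∣ ∑ δ ∈ N.divisors with δ.factorization 2 = 1, r δ * (ordCompl[2] (N / δ) : ℤ) ∧
    (8 : ℤ) ∣ ∑ δ ∈ N.divisors with δ.factorization 2 = 2, r δ * (ordCompl[2] (N / δ) : ℤ) := by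
  have h0 := two_pow_dvd_sum_R_of_hasEvenCuspOrders hN hev (k := 0) (by omega)
  have h1 := two_pow_dvd_sum_R_of_hasEvenCuspOrders hN hev (k := 1) (by omega)
  have h2 := two_pow_dvd_sum_R_of_hasEvenCuspOrders hN hev (k := 2) (by omega)
  rw [hn] at h0 h1 h2
  simp only [sum_range_succ, sum_range_zero, zero_add] at h0 h1 h2
  norm_num at h0 h1 h2
  omega

/-- **`8 ∥ N`: `R₀`, `R₂` even** from the cusps `1, 1/2, 1/4, 1/8`. -/
theorem R_parity_of_factorization_two_eq_three {N : ℕ} (hN : N ≠ 0) {r : ℕ → ℤ}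
    (hev : HasEvenCuspOrders N (fun t => 2 * r t)) (hn : N.factorization 2 = 3) :
    (2 : ℤ) ∣ ∑ δ ∈ N.divisors with δ.factorization 2 = 0, r δ * (ordCompl[2] (N / δ) : ℤ) ∧
    (2 : ℤ) ∣ ∑ δ ∈ N.divisors with δ.factorization 2 = 2, r δ * (ordCompl[2] (N / δ) : ℤ) := by
  have h0 := two_pow_dvd_sum_R_of_hasEvenCuspOrders hN hev (k := 0) (by omega)
  have h1 := two_pow_dvd_sum_R_of_hasEvenCuspOrders hN hev (k := 1) (by omega)
  have h2 := two_pow_dvd_sum_R_of_hasEvenCuspOrders hN hev (k := 2) (by omega)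
  have h3 := two_pow_dvd_sum_R_of_hasEvenCuspOrders hN hev (k := 3) (by omega)
  rw [hn] at h0 h1 h2 h3
  simp only [sum_range_succ, sum_range_zero, zero_add] at h0 h1 h2 h3
  norm_num at h0 h1 h2 h3
  omega

/-- **`16 ∥ N`: `R₀`, `R₂`, `R₄` even** from the cusps `1/2, 1/4, 1/8`. -/
theorem R_parity_of_factorization_two_eq_four {N : ℕ} (hN : N ≠ 0) {r : ℕ → ℤ}
    (hev : HasEvenCuspOrders N (fun t => 2 * r t)) (hn : N.factorization 2 = 4) :
    (2 : ℤ) ∣ ∑ δ ∈ N.divisors with δ.factorization 2 = 0, r δ * (ordCompl[2] (N / δ) : ℤ) ∧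
    (2 : ℤ) ∣ ∑ δ ∈ N.divisors with δ.factorization 2 = 2, r δ * (ordCompl[2] (N / δ) : ℤ) ∧
    (2 : ℤ) ∣ ∑ δ ∈ N.divisors with δ.factorization 2 = 4, r δ * (ordCompl[2] (N / δ) : ℤ) := by
  have h1 := two_pow_dvd_sum_R_of_hasEvenCuspOrders hN hev (k := 1) (by omega)
  have h2 := two_pow_dvd_sum_R_of_hasEvenCuspOrders hN hev (k := 2) (by omega)
  have h3 := two_pow_dvd_sum_R_of_hasEvenCuspOrders hN hev (k := 3) (by omega)
  rw [hn] at h1 h2 h3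
  simp only [sum_range_succ, sum_range_zero, zero_add] at h1 h2 h3
  norm_num at h1 h2 h3
  omega

/-! ## §4 From `R`-parities to the two parity lemmas (using the weight condition `Σ r_t = 0`) -/

/-- `|x| − x` is even. -/
private theorem two_dvd_abs_sub (x : ℤ) : (2 : ℤ) ∣ |x| - x := by
  rcases le_or_gt 0 x with h | h
  · rw [abs_of_nonneg h, sub_self]; exact dvd_zero 2
  · rw [abs_of_neg h]; exact ⟨-x, by ring⟩

/-- The fiber sum `R_a` and the plain fiber sum `Σ_{v₂ t = a} r_t` have the same parity (the weights `oddpart(N/t)` are odd). -/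
theorem two_dvd_R_sub_fiberSum {N : ℕ} (hN : N ≠ 0) (r : ℕ → ℤ) (a : ℕ) :
    (2 : ℤ) ∣ (∑ δ ∈ N.divisors with δ.factorization 2 = a, r δ * (ordCompl[2] (N / δ) : ℤ)) -
      ∑ δ ∈ N.divisors with δ.factorization 2 = a, r δ := by
  rw [← sum_sub_distrib]
  refine dvd_sum fun δ hδ => ?_
  have hδN : δ ∣ N := Nat.dvd_of_mem_divisors (mem_filter.mp hδ).1
  have hq0 : N / δ ≠ 0 := (Nat.div_pos (Nat.le_of_dvd (Nat.pos_of_ne_zero hN) hδN)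
    (Nat.pos_of_ne_zero (by rintro rfl; exact hN (zero_dvd_iff.mp hδN)))).ne'
  obtain ⟨j, hj⟩ := odd_ordCompl_two hq0
  have hw : ((ordCompl[2] (N / δ) : ℕ) : ℤ) = 2 * (j : ℤ) + 1 := by exact_mod_cast hj
  have e : r δ * ((ordCompl[2] (N / δ) : ℕ) : ℤ) - r δ = 2 * (r δ * j) := by rw [hw]; ring
  exact ⟨_, e⟩

/-- The fiber sums add up to `Σ_{t ∣ N} r_t`. -/
theorem sum_fiberSum_eq {N : ℕ} (hN : N ≠ 0) (r : ℕ → ℤ) :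
    ∑ a ∈ range (N.factorization 2 + 1), ∑ δ ∈ N.divisors with δ.factorization 2 = a, r δ =
      ∑ δ ∈ N.divisors, r δ :=
  sum_fiberwise_of_maps_to (fun _ hδ => mem_range.mpr
    (Nat.lt_succ_of_le (factorization_two_le_of_dvd hN (Nat.dvd_of_mem_divisors hδ)))) _

/-- The 2-adic weight regrouped: `Σ_t r_t · v₂(t) = Σ_a a · (Σ_{v₂ t = a} r_t)`. -/
theorem sum_mul_factorization_two_eq {N : ℕ} (hN : N ≠ 0) (r : ℕ → ℤ) :
    ∑ δ ∈ N.divisors, r δ * (δ.factorization 2 : ℤ) =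
      ∑ a ∈ range (N.factorization 2 + 1), (a : ℤ) * ∑ δ ∈ N.divisors with δ.factorization 2 = a, r δ := by
  rw [← sum_fiberwise_of_maps_to (g := fun δ => δ.factorization 2) (t := range (N.factorization 2 + 1))
    (fun δ hδ => mem_range.mpr
      (Nat.lt_succ_of_le (factorization_two_le_of_dvd hN (Nat.dvd_of_mem_divisors hδ))))]
  refine sum_congr rfl fun a _ => ?_
  rw [mul_sum]
  refine sum_congr rfl fun δ hδ => ?_
  rw [(mem_filter.mp hδ).2, mul_comm]

/-- `4 ∣ N`, `¬ 32 ∣ N` pins `v₂ N ∈ {2, 3, 4}`. -/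
private theorem factorization_two_mem {N : ℕ} (hN : N ≠ 0) (h4 : 4 ∣ N) (h32 : ¬ 32 ∣ N) :
    N.factorization 2 = 2 ∨ N.factorization 2 = 3 ∨ N.factorization 2 = 4 := by
  have h2 : 2 ≤ N.factorization 2 :=
    (Nat.prime_two.pow_dvd_iff_le_factorization hN).mp (by norm_num at h4 ⊢; exact h4)
  have h5 : ¬ 5 ≤ N.factorization 2 := fun h =>
    h32 (by have := (Nat.prime_two.pow_dvd_iff_le_factorization hN).mpr h; norm_num at this; exact this)
  omega

/-- **PARITY LEMMA (A): at `4 ∣ N`, `32 ∤ N`, even cusp orders of `G_{2r}` and `Σ r_t = 0` force `Σ_t |r_t|·v₂(t)` to be EVEN**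
— so a `χ₈`-constituent of the Kronecker character `(∏ t^{|r_t|} | ·)` occurs only when `32 ∣ N`.  (an's v₂-lemma at `4 ∥ N`,
MEMO-an §77.11 (3), extended to `8 ∥ N` and `16 ∥ N`.) -/
theorem even_twoAdicWeight_of_hasEvenCuspOrders {N : ℕ} (hN : N ≠ 0) (h4 : 4 ∣ N) (h32 : ¬ 32 ∣ N)
    {r : ℕ → ℤ} (hsum : ∑ δ ∈ N.divisors, r δ = 0) (hev : HasEvenCuspOrders N (fun t => 2 * r t)) :
    Even (∑ δ ∈ N.divisors, (r δ).natAbs * δ.factorization 2) := by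
  rw [even_iff_two_dvd, ← Int.natCast_dvd_natCast]
  push_cast
  -- pass from `|r_t|` to `r_t`
  have hpar : (2 : ℤ) ∣ (∑ δ ∈ N.divisors, |r δ| * (δ.factorization 2 : ℤ)) -
      ∑ δ ∈ N.divisors, r δ * (δ.factorization 2 : ℤ) := by
    rw [← sum_sub_distrib]
    exact dvd_sum fun δ _ => by rw [← sub_mul]; exact (two_dvd_abs_sub (r δ)).mul_right _
  suffices h : (2 : ℤ) ∣ ∑ δ ∈ N.divisors, r δ * (δ.factorization 2 : ℤ) by
    have := dvd_add hpar h; rwa [sub_add_cancel] at this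
  rw [sum_mul_factorization_two_eq hN]
  have htot := sum_fiberSum_eq hN r
  rw [hsum] at htot
  have hf := fun a => two_dvd_R_sub_fiberSum hN r a
  rcases factorization_two_mem hN h4 h32 with hn | hn | hn
  · obtain ⟨hR0, -, hR2⟩ := R_parity_of_factorization_two_eq_two hN hev hn
    have hf0 := hf 0; have hf2 := hf 2
    rw [hn] at htot ⊢
    simp only [sum_range_succ, sum_range_zero, zero_add] at htot ⊢
    push_cast
    omega
  · obtain ⟨hR0, hR2⟩ := R_parity_of_factorization_two_eq_three hN hev hn
    have hf0 := hf 0; have hf2 := hf 2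
    rw [hn] at htot ⊢
    simp only [sum_range_succ, sum_range_zero, zero_add] at htot ⊢
    push_cast
    omega
  · obtain ⟨hR0, hR2, hR4⟩ := R_parity_of_factorization_two_eq_four hN hev hn
    have hf0 := hf 0; have hf2 := hf 2; have hf4 := hf 4
    rw [hn] at htot ⊢
    simp only [sum_range_succ, sum_range_zero, zero_add] at htot ⊢
    push_cast
    omega

/-- `4 ∣ N`, `¬ 8 ∣ N` pins `v₂ N = 2`. -/
private theorem factorization_two_eq_two {N : ℕ} (hN : N ≠ 0) (h4 : 4 ∣ N) (h8 : ¬ 8 ∣ N) :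
    N.factorization 2 = 2 := by
  have h2 : 2 ≤ N.factorization 2 :=
    (Nat.prime_two.pow_dvd_iff_le_factorization hN).mp (by norm_num at h4 ⊢; exact h4)
  have h3 : ¬ 3 ≤ N.factorization 2 := fun h =>
    h8 (by have := (Nat.prime_two.pow_dvd_iff_le_factorization hN).mpr h; norm_num at this; exact this)
  omega

/-- For an odd `u`: `u ≡ 1 + 2·[u ≡ 3 (mod 4)] (mod 4)`. -/
private theorem four_dvd_sub_indicator {u : ℕ} (hu : Odd u) :
    (4 : ℤ) ∣ (u : ℤ) - 1 - 2 * (if u % 4 = 3 then 1 else 0 : ℤ) := by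
  have hdm := Nat.div_add_mod u 4
  rcases (Nat.odd_mod_four_iff.mp (Nat.odd_iff.mp hu)) with h | h
  · rw [if_neg (by omega)]; exact ⟨(u / 4 : ℕ), by push_cast; omega⟩
  · rw [if_pos h]; exact ⟨(u / 4 : ℕ), by push_cast; omega⟩

/-- For an odd `u`: `4 ∣ u² − 1`, in the form `4 ∣ w − w·u·u` for any `w`. -/
private theorem four_dvd_sub_mul_mul_of_odd (w : ℤ) {u : ℕ} (hu : Odd u) :
    (4 : ℤ) ∣ w - w * u * u := by
  obtain ⟨j, hj⟩ := hu
  rw [hj]; push_cast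
  exact ⟨-(w * j * (j + 1)), by ring⟩

/-- **PARITY LEMMA (B): at `4 ∥ N`, even cusp orders of `G_{2r}` and `Σ r_t = 0` force `#{t : |r_t| odd, oddpart(t) ≡ 3 (4)}`
to be EVEN** — so a `χ₋₄`-constituent of the Kronecker character `(∏ t^{|r_t|} | ·)` occurs only when `8 ∣ N`.
(`4 ∣ R₀ + R₁ + R₂ = Σ_t r_t·oddpart(N/t) ≡ m·Σ_t r_t·oddpart(t) (mod 4)`, `m = oddpart N`, and
`oddpart(t) ≡ 1 + 2·[≡ 3 (4)] (mod 4)`.) -/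
theorem even_threeModFourCount_of_hasEvenCuspOrders {N : ℕ} (hN : N ≠ 0) (h4 : 4 ∣ N) (h8 : ¬ 8 ∣ N)
    {r : ℕ → ℤ} (hsum : ∑ δ ∈ N.divisors, r δ = 0) (hev : HasEvenCuspOrders N (fun t => 2 * r t)) :
    Even (∑ δ ∈ N.divisors, (r δ).natAbs * (if ordCompl[2] δ % 4 = 3 then 1 else 0)) := by
  have hn := factorization_two_eq_two hN h4 h8
  obtain ⟨hR0, hR1, hR2⟩ := R_parity_of_factorization_two_eq_two hN hev hn
  -- `R₀ + R₁ + R₂ = Σ_t r_t · oddpart(N/t)`, divisible by `4`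
  have hRtot : ∑ a ∈ range (N.factorization 2 + 1),
      ∑ δ ∈ N.divisors with δ.factorization 2 = a, r δ * (ordCompl[2] (N / δ) : ℤ) =
        ∑ δ ∈ N.divisors, r δ * (ordCompl[2] (N / δ) : ℤ) :=
    sum_fiberwise_of_maps_to (fun _ hδ => mem_range.mpr
      (Nat.lt_succ_of_le (factorization_two_le_of_dvd hN (Nat.dvd_of_mem_divisors hδ)))) _
  rw [hn] at hRtot
  simp only [sum_range_succ, sum_range_zero, zero_add] at hRtot
  have h4w : (4 : ℤ) ∣ ∑ δ ∈ N.divisors, r δ * (ordCompl[2] (N / δ) : ℤ) := by rw [← hRtot]; omega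
  -- `oddpart(N/t) ≡ m · oddpart(t) (mod 4)`, `m = oddpart N` odd
  have hm : Odd (ordCompl[2] N) := odd_ordCompl_two hN
  have hkey : (4 : ℤ) ∣ (∑ δ ∈ N.divisors, r δ * (ordCompl[2] (N / δ) : ℤ)) -
      (ordCompl[2] N : ℤ) * ∑ δ ∈ N.divisors, r δ * (ordCompl[2] δ : ℤ) := by
    rw [mul_sum, ← sum_sub_distrib]
    refine dvd_sum fun δ hδ => ?_
    have hδN : δ ∣ N := Nat.dvd_of_mem_divisors hδ
    have hδ0 : δ ≠ 0 := by rintro rfl; exact hN (zero_dvd_iff.mp hδN)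
    have hwu : ((ordCompl[2] (N / δ) : ℕ) : ℤ) * ((ordCompl[2] δ : ℕ) : ℤ) = ((ordCompl[2] N : ℕ) : ℤ) := by
      rw [← Nat.cast_mul, ← Nat.ordCompl_mul, Nat.div_mul_cancel hδN]
    have e : r δ * ((ordCompl[2] (N / δ) : ℕ) : ℤ) - ((ordCompl[2] N : ℕ) : ℤ) * (r δ * ((ordCompl[2] δ : ℕ) : ℤ)) =
        r δ * (((ordCompl[2] (N / δ) : ℕ) : ℤ) -
          ((ordCompl[2] (N / δ) : ℕ) : ℤ) * ((ordCompl[2] δ : ℕ) : ℤ) * ((ordCompl[2] δ : ℕ) : ℤ)) := by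
      rw [← hwu]; ring
    show (4 : ℤ) ∣ r δ * ((ordCompl[2] (N / δ) : ℕ) : ℤ) -
      ((ordCompl[2] N : ℕ) : ℤ) * (r δ * ((ordCompl[2] δ : ℕ) : ℤ))
    rw [e]
    exact (four_dvd_sub_mul_mul_of_odd _ (odd_ordCompl_two hδ0)).mul_left _
  -- hence `4 ∣ m · Σ r_t oddpart(t)`, and `m` odd gives `4 ∣ Σ r_t oddpart(t)`
  have h4mu : (4 : ℤ) ∣ (ordCompl[2] N : ℤ) * ∑ δ ∈ N.divisors, r δ * (ordCompl[2] δ : ℤ) := by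
    have := dvd_sub h4w hkey; rwa [sub_sub_cancel] at this
  have h4u : (4 : ℤ) ∣ ∑ δ ∈ N.divisors, r δ * (ordCompl[2] δ : ℤ) := by
    set U := ∑ δ ∈ N.divisors, r δ * (ordCompl[2] δ : ℤ) with hU
    have hsq : (4 : ℤ) ∣ U - U * (ordCompl[2] N : ℕ) * (ordCompl[2] N : ℕ) :=
      four_dvd_sub_mul_mul_of_odd U hm
    have e : U = (U - U * (ordCompl[2] N : ℕ) * (ordCompl[2] N : ℕ)) +
        (ordCompl[2] N : ℕ) * ((ordCompl[2] N : ℕ) * U) := by ring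
    rw [e]
    exact dvd_add hsq (h4mu.mul_left _)
  -- `oddpart(t) ≡ 1 + 2·λ_t (mod 4)` and `Σ r_t = 0` give `2 ∣ Σ r_t λ_t`
  have h4ind : (4 : ℤ) ∣ (∑ δ ∈ N.divisors, r δ * (ordCompl[2] δ : ℤ)) - (∑ δ ∈ N.divisors, r δ) -
      2 * ∑ δ ∈ N.divisors, r δ * (if ordCompl[2] δ % 4 = 3 then 1 else 0 : ℤ) := by
    rw [mul_sum, ← sum_sub_distrib, ← sum_sub_distrib]
    refine dvd_sum fun δ hδ => ?_
    have hδN : δ ∣ N := Nat.dvd_of_mem_divisors hδ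
    have hδ0 : δ ≠ 0 := by rintro rfl; exact hN (zero_dvd_iff.mp hδN)
    have e : r δ * ((ordCompl[2] δ : ℕ) : ℤ) - r δ - 2 * (r δ * (if ordCompl[2] δ % 4 = 3 then 1 else 0 : ℤ)) =
        r δ * (((ordCompl[2] δ : ℕ) : ℤ) - 1 - 2 * (if ordCompl[2] δ % 4 = 3 then 1 else 0 : ℤ)) := by ring
    show (4 : ℤ) ∣ r δ * ((ordCompl[2] δ : ℕ) : ℤ) - r δ -
      2 * (r δ * (if ordCompl[2] δ % 4 = 3 then 1 else 0 : ℤ))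
    rw [e]
    exact (four_dvd_sub_indicator (odd_ordCompl_two hδ0)).mul_left _
  rw [hsum, sub_zero] at h4ind
  have hlam : (2 : ℤ) ∣ ∑ δ ∈ N.divisors, r δ * (if ordCompl[2] δ % 4 = 3 then 1 else 0 : ℤ) := by
    have h4' := dvd_sub h4u h4ind
    rw [sub_sub_cancel] at h4'
    have h22 : (2 : ℤ) * 2 ∣ 2 * ∑ δ ∈ N.divisors, r δ * (if ordCompl[2] δ % 4 = 3 then 1 else 0 : ℤ) := by
      simpa [show (2 : ℤ) * 2 = 4 by norm_num] using h4'
    exact (mul_dvd_mul_iff_left two_ne_zero).mp h22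
  -- from `r_t` to `|r_t|`
  rw [even_iff_two_dvd, ← Int.natCast_dvd_natCast]
  push_cast
  have hpar : (2 : ℤ) ∣ (∑ δ ∈ N.divisors, |r δ| * (if ordCompl[2] δ % 4 = 3 then 1 else 0 : ℤ)) -
      ∑ δ ∈ N.divisors, r δ * (if ordCompl[2] δ % 4 = 3 then 1 else 0 : ℤ) := by
    rw [← sum_sub_distrib]
    exact dvd_sum fun δ _ => by rw [← sub_mul]; exact (two_dvd_abs_sub (r δ)).mul_right _
  have := dvd_add hpar hlam
  rwa [sub_add_cancel] at this

end Summit.BirchSwinnertonDyer.BirchSwinnertonDyer.Theorems.ManinLocalTwoThree
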